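import Mathlib.AlgebraicGeometry.IdealSheaf.Basic
import Mathlib.AlgebraicGeometry.IdealSheaf.Functorial
import HarnessLib

/-!
# Restriction of a finite product of ideal sheaves along an open immersion

Support file for crux stmt-ResolutionOfSingularities-15315
(`FrobeniusLadder.FInjectiveMacaulayfication`, line `Sketch`, seat c6): stub
`stub_comapFinsetProdOfIsOpenImmersion`.

The surgery glue of the F-injective Macaulayfication blows up, on an integral model with finitely
many bad closed points `T`, the product ideal sheaf `∏_{b ∈ T} J b` of point-supported centres,
and needs to see this product near one bad point `b`, i.e. after restriction along the open
immersion `ι : U ⟶ X` of a neighbourhood of `b` missing the other bad points. This file proves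
that the restriction `Scheme.IdealSheafData.comap · ι` along an open immersion commutes with
finite products of ideal sheaves:

* `ideal_comap_mul_of_ringEquiv`, `ideal_comap_mul_of_isIso` — contraction of ideals along a
  ring isomorphism is multiplicative (it is extension along the inverse, `Ideal.map_symm`, and
  extension is multiplicative, `Ideal.map_mul`);
* `comap_mul_of_isOpenImmersion` — `(I * K)|_U = I|_U * K|_U`: on an affine open `V ⊆ U` both
  sides are the contraction of `(I * K)(ι(V)) = I(ι(V)) * K(ι(V))` along the isomorphism
  `Γ(U, V) ≅ Γ(X, ι(V))` (Mathlib's `ideal_comap_of_isOpenImmersion` and `ideal_mul`);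
* `comap_finset_prod_of_isOpenImmersion` and the registered signature
  `stub_comapFinsetProdOfIsOpenImmersion` — induction on the finite index set, the empty product
  being the unit ideal sheaf `⊤`, which restricts to `⊤` (`comap_top`).

References: folklore bookkeeping over Mathlib's `AlgebraicGeometry.IdealSheaf` API (inverse
image ideal sheaves, cf. The Stacks Project, Tag 01HJ); no definition is declared. [folklore]
-/

-- single-problem summit: the doubled namespace component `ResolutionOfSingularities` is forced
set_option linter.dupNamespace false

noncomputable section

namespace Summit.ResolutionOfSingularities.ResolutionOfSingularities.Theorems.FInjectiveMacaulayfication.ComapFinsetProd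

open AlgebraicGeometry CategoryTheory

universe u v w

/-- Contraction of ideals along a ring isomorphism `e : R ≃+* S` is multiplicative:
`e⁻¹(I * J) = e⁻¹(I) * e⁻¹(J)` (it is extension along `e.symm`). [folklore] -/
theorem ideal_comap_mul_of_ringEquiv {R : Type v} {S : Type w} [CommSemiring R] [CommSemiring S]
    (e : R ≃+* S) (I J : Ideal S) : (I * J).comap e = I.comap e * J.comap e := by
  rw [← Ideal.map_symm, ← Ideal.map_symm, ← Ideal.map_symm, Ideal.map_mul]

/-- Contraction of ideals along an isomorphism `g : A ⟶ B` of bundled commutative rings is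
multiplicative. [folklore] -/
theorem ideal_comap_mul_of_isIso {A B : CommRingCat.{u}} (g : A ⟶ B) [IsIso g] (I J : Ideal B) :
    (I * J).comap g.hom = I.comap g.hom * J.comap g.hom := by
  have h : ∀ K : Ideal B, K.comap g.hom = K.comap (asIso g).commRingCatIsoToRingEquiv :=
    fun K => rfl
  rw [h, h, h]
  exact ideal_comap_mul_of_ringEquiv _ I J

/-- **Restriction along an open immersion is multiplicative on ideal sheaves**: for an open
immersion `f : X ⟶ Y` and ideal sheaves `I`, `K` on `Y`,
`(I * K).comap f = I.comap f * K.comap f`. On an affine open `V` of `X` both sides are the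
contraction of `I(f(V)) * K(f(V))` along the isomorphism `Γ(X, V) ≅ Γ(Y, f(V))`. [folklore] -/
theorem comap_mul_of_isOpenImmersion {X Y : Scheme.{u}} (f : X ⟶ Y) [IsOpenImmersion f]
    (I K : Y.IdealSheafData) : (I * K).comap f = I.comap f * K.comap f := by
  refine Scheme.IdealSheafData.ext (funext fun V => ?_)
  rw [Scheme.IdealSheafData.ideal_mul, Pi.mul_apply,
    Scheme.IdealSheafData.ideal_comap_of_isOpenImmersion,
    Scheme.IdealSheafData.ideal_comap_of_isOpenImmersion,
    Scheme.IdealSheafData.ideal_comap_of_isOpenImmersion,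
    Scheme.IdealSheafData.ideal_mul, Pi.mul_apply]
  exact ideal_comap_mul_of_isIso _ _ _

/-- **Restriction along an open immersion commutes with finite products of ideal sheaves**:
`(∏_{i ∈ s} J i).comap f = ∏_{i ∈ s} (J i).comap f` for an open immersion `f`. [folklore] -/
theorem comap_finset_prod_of_isOpenImmersion {X Y : Scheme.{u}} (f : X ⟶ Y) [IsOpenImmersion f]
    {T : Type v} (s : Finset T) (J : T → Y.IdealSheafData) :
    (∏ i ∈ s, J i).comap f = ∏ i ∈ s, (J i).comap f := by
  classical
  induction s using Finset.induction_on with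
  | empty =>
    rw [Finset.prod_empty, Finset.prod_empty, Scheme.IdealSheafData.one_eq_top,
      Scheme.IdealSheafData.one_eq_top, Scheme.IdealSheafData.comap_top]
  | insert a s ha ih =>
    rw [Finset.prod_insert ha, Finset.prod_insert ha, comap_mul_of_isOpenImmersion, ih]

/-- **Stub `stub_comapFinsetProdOfIsOpenImmersion`** (surgery glue piece of the F-injective
Macaulayfication): for an open immersion `ι : U ⟶ X`, a finite set `s` of indices and ideal
sheaves `J i` on `X`, the restriction of the product is the product of the restrictions,
`(∏_{i ∈ s} J i).comap ι = ∏_{i ∈ s} (J i).comap ι`. [folklore] -/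
theorem stub_comapFinsetProdOfIsOpenImmersion : ∀ (X U : Scheme.{0}) (ι : U ⟶ X) [IsOpenImmersion ι]
    (T : Type) (s : Finset T) (J : T → X.IdealSheafData),
    (∏ i ∈ s, J i).comap ι = ∏ i ∈ s, (J i).comap ι :=
  fun _ _ ι _ _ s J => comap_finset_prod_of_isOpenImmersion ι s J

end Summit.ResolutionOfSingularities.ResolutionOfSingularities.Theorems.FInjectiveMacaulayfication.ComapFinsetProd

end
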